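import Summits.CriticalPhenomena.PercolationContinuityZ3.Theorems.PercNearOneGluingNoHeavyLowerTailSunflowerLayeredConditioning
import HarnessLib
import HarnessLib.Audit

/-!
# `NoHeavyLowerTail` (crux stmt-CriticalPhenomena-4575), abstract sunflower cubic: THE GADGET MODEL — the finite combinatorial
# statement behind the odd cycles (and every "bipartite graph + handle"), and its bridge to `TermWeightedIneq`

Support file (seat `prim-ineq-prove-1` gen 71; `--supports stmt-CriticalPhenomena-4575`).  No `sorry`, no named facts.  The
`@[conjecture]` definition is an obligation of this programme (census- and adversary-true, unproved), used only as an explicit hypothesis.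
Memo: run/shared/lean/prim/prim-ineq-prove-1/FINDING-LAYERED-prove1-g71.md §3.

THE SETTING.  A layered conditioning set `A` of a triangle-free graph (`…SunflowerLayeredConditioning`) whose typeless vertices are
exactly one edge `b – c` (for the odd cycle `C_{2k+3}` and gen 70's `A = {3,5,…,2k+1}`: `b = 0`, `c = 1`; in general: a bipartite graph
on `A ⊔ T` plus an edge `b c` with `N(b) ∖ c`, `N(c) ∖ b ⊆ T` — the "handle family").  Conditioning on the `A`-parts of the rows turns
the term into gen 40's TYPE MODEL (`…SunflowerTypeModel`) enriched by the two typeless elements `b, c`: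
* every slot `k` has a MODE `β ∈ {none, b, c}` (which of `b, c` its row holds; both = dead), i.e. there are `3K` EXTENDED SLOTS `(k, β)`;
* an element `x` KILLS the extended slot `(k, β)` iff `k ∈ τ₀ x` (a neighbour in the `A`-part) or (`β = b` and `x ∈ N_T(b)`) or
  (`β = c` and `x ∈ N_T(c)`) — the sets `N_T(b)`, `N_T(c)` are GLOBAL (the same for every slot; dropping this makes the lemma false);
* petal LABELS `lab (k, β)` (two completions of the same slot with the same mode cannot lie in distinct petals: `eq_of_rowOf_mem_Wof'`),
  and an ORIENTATION `O e' e` on extended slots ("every petal row of `e` holds a killer of `e'`") with an arc between any two extended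
  slots of distinct labels EXCEPT the `b`/`c` pairs (whose rows are cross-edged through the edge `b c` itself): `OOf'_or_OOf'`.
`GadgetModel.Model` records exactly this; `Bad`/`Good`/`nonA` are as in the type model (a slot is P iff labelled and holding a witness for
every in-neighbour).  **`GadgetModelLemma`** (typed conjecture): `Σ_{BAD} (K − |N|)! ≤ (K−1)!·#GOOD` for every gadget model and profile.
With `b, c` absent it is `TypeModel.Model.typeModel_lemma` (g40); memo §3: the derived models of cycle terms (`C₅…C₉`, `K ≤ 4`;
> 2.8·10⁵ terms in the per-gadget-content formulation, ≈ 10³ terms locally + kit j307662 in exactly this file's formulation) and of the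
handle-family graphs tested (`C₅` + pendant path, `C₅` + handle, `C₇` + pendant, `C₉` + chord) satisfy the axioms and the lemma, and the
lemma survives simulated-annealing adversaries over abstract models (`K ≤ 4`; kit j307096, j307283, j307510: best ratio exactly `1`, never
above); WITHOUT the label axiom on same-slot pairs, or with slot-dependent `N_T(b)`, it is false (explicit abstract counterexamples).
THE BRIDGE (modelled on `…SunflowerBipartiteConditioning`/`…BipartiteSafe`) is split over three files: this one — the model, the
conjecture, the hypotheses `HandleHyp Γ A b c V`, modes `modeT`, killer sets `KillsT`, petal rows, and ONE LABEL PER EXTENDED SLOT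
(`eq_of_petRow`, `labH`, `labH_eq_some`); `…SunflowerGadgetModelBridge` — compatibility `OH_or_OH`, the instance `gadgetModelOf`, the
transports; `…SunflowerGadgetModelSafe` — **`termWeightedIneq_of_gadgetModelLemma : HandleGraph Γ A b c → GadgetModelLemma →
TermWeightedIneq Γ A`**, `safe_of_gadgetModelLemma` (the handle family), `oddCycleTermWeighted_of_gadgetModelLemma`.
-/

namespace Summit.CriticalPhenomena.PercolationContinuityZ3.Theorems.SunflowerPartition

/-! ### The abstract gadget model -/

namespace GadgetModel

open Finset

/-- The mode of a live slot: which of the two typeless elements `b`, `c` its row holds (`none` = neither). -/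
inductive Mode
  | none
  | b
  | c
  deriving DecidableEq

/-- An extended slot: a slot together with a mode. -/
abbrev Ext (K : ℕ) := Fin K × Mode

/-- The pairs of modes `{b, c}`: rows of these modes are cross-edged through the edge `b c` itself, so no arc is required. -/
def bcPair (β β' : Mode) : Prop := (β = Mode.b ∧ β' = Mode.c) ∨ (β = Mode.c ∧ β' = Mode.b)


variable {K : ℕ} {ι Λ : Type*}

/-- The abstract **gadget model** with `K` slots (memo §3): gen 40's type model (`τ₀`, labels, orientation) over the `3K` extended slots,
two distinguished typeless elements `vb, vc`, and the two GLOBAL killer sets `Nb` (kills every row of mode `b`) and `Nc`. [this work] -/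
structure Model (K : ℕ) (ι Λ : Type*) where
  /-- the typeless element `b` -/
  vb : ι
  /-- the typeless element `c` -/
  vc : ι
  hbc : vb ≠ vc
  /-- static killer type of an element (`k ∈ τ₀ x` iff `x` kills every row of slot `k`) -/
  τ₀ : ι → Finset (Fin K)
  /-- elements killing every row of mode `b` (the `T`-neighbours of `b`) -/
  Nb : Finset ι
  /-- elements killing every row of mode `c` -/
  Nc : Finset ι
  τ₀_vb : τ₀ vb = ∅
  τ₀_vc : τ₀ vc = ∅
  vb_notMem : vb ∉ Nb ∧ vb ∉ Nc
  vc_notMem : vc ∉ Nb ∧ vc ∉ Nc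
  disj : Disjoint Nb Nc
  /-- petal label of an extended slot (`none`: no petal row of that slot and mode) -/
  lab : Ext K → Option Λ
  /-- orientation: `O e' e` means every petal row of the extended slot `e` holds a killer of `e'` -/
  O : Ext K → Ext K → Prop
  /-- extended slots with distinct (present) labels are joined by an arc, unless their modes are `{b, c}` -/
  arc : ∀ e e' : Ext K, e ≠ e' → lab e ≠ none → lab e' ≠ none → lab e ≠ lab e' → ¬ bcPair e.2 e'.2 → O e e' ∨ O e' e

namespace Model

variable (M : Model K ι Λ) (S : ι → Finset (Fin K))

/-- Element `x` kills the extended slot `(k, β)`. -/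
def Kills (x : ι) (e : Ext K) : Prop :=
  e.1 ∈ M.τ₀ x ∨ (e.2 = Mode.b ∧ x ∈ M.Nb) ∨ (e.2 = Mode.c ∧ x ∈ M.Nc)

/-- Slot `k` holds both typeless elements: dead by the edge `b c`. -/
def Dead (k : Fin K) : Prop := k ∈ S M.vb ∧ k ∈ S M.vc

/-- The mode of slot `k` (meaningful when the slot is not `Dead`). -/
def mode (k : Fin K) : Mode := if k ∈ S M.vb then Mode.b else if k ∈ S M.vc then Mode.c else Mode.none

/-- The extended slot of `k` in the configuration `S`. -/
def ext (k : Fin K) : Ext K := (k, M.mode S k)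

/-- Slot `k` holds a killer of the extended slot `e`. -/
def HasWit (k : Fin K) (e : Ext K) : Prop := ∃ x, k ∈ S x ∧ M.Kills x e

/-- **A-slot**: dead by `b c`, or holding a killer of its own extended slot. -/
def IsA (k : Fin K) : Prop := M.Dead S k ∨ M.HasWit S k (M.ext S k)

/-- **P-slot**: alive, labelled, and holding a witness for every in-neighbour of its extended slot. -/
def IsP (k : Fin K) : Prop := ¬ M.IsA S k ∧ M.lab (M.ext S k) ≠ none ∧ ∀ e', M.O e' (M.ext S k) → M.HasWit S k e'

/-- The set of non-A slots. -/
noncomputable def nonA : Finset (Fin K) := by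
  classical exact univ.filter fun k => ¬ M.IsA S k

/-- **BAD**: at least two non-A slots, all P, with pairwise distinct labels. -/
def Bad : Prop :=
  2 ≤ (M.nonA S).card ∧ (∀ k ∈ M.nonA S, M.IsP S k) ∧
    ∀ k ∈ M.nonA S, ∀ l ∈ M.nonA S, k ≠ l → M.lab (M.ext S k) ≠ M.lab (M.ext S l)

/-- **GOOD**: exactly one non-A slot, and it is not P. -/
def Good : Prop := ∃ z, M.nonA S = {z} ∧ ¬ M.IsP S z

/-- Membership in the non-A set: neither dead by `b c` nor holding a killer of its own extended slot. [this work] -/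
theorem mem_nonA_iff {k : Fin K} : k ∈ M.nonA S ↔ ¬ (M.Dead S k ∨ M.HasWit S k (M.ext S k)) := by
  classical
  unfold nonA IsA; simp

open scoped Classical in
/-- The weighted inequality of the gadget model `M` for the profile `m` (configurations `TypeModel.Model.confs m`). -/
def WeightedLemma [Fintype ι] (M : Model K ι Λ) : Prop :=
  ∀ m : ι → ℕ, ∑ S ∈ (TypeModel.Model.confs m).filter (fun S => M.Bad S), (K - (M.nonA S).card).factorial ≤
    (K - 1).factorial * ((TypeModel.Model.confs m).filter fun S => M.Good S).card

end Model

/-- **TYPED CONJECTURE (`GadgetModelLemma`)**: the weighted inequality `Σ_{BAD} (K − |N|)! ≤ (K−1)!·#GOOD` holds for every gadget model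
and every profile (memo §3: census on all models derived from cycle / handle terms, annealing adversaries; the case without the typeless
elements is g40's `typeModel_lemma`).  It implies `TermWeightedIneq` for every layered conditioning set whose typeless part is one edge
(`termWeightedIneq_of_gadgetModelLemma`), hence `OddCycleTermWeighted` and the A-safety of the whole handle family.  An obligation of this
programme, never used as a fact. [conjecture, this work] -/
@[conjecture] def GadgetModelLemma : Prop :=
  ∀ (K : ℕ) (ι Λ : Type) [Fintype ι] [DecidableEq ι] [DecidableEq Λ] (M : Model K ι Λ), M.WeightedLemma

end GadgetModel

/-! ### The bridge: a layered conditioning set whose typeless part is one edge -/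

namespace Bridge

open Finset MeasureTheory Literature.Probability.LatticeModels Literature.Probability.Percolation GadgetModel

variable {K n : ℕ}

section Handle

variable (Γ : SimpleGraph (Fin n)) (A : Finset (Fin n)) (b c : Fin n) (V : Fin K → Set (Set (Fin n)))

/-- The hypotheses of the bridge: `A` is independent, the vertices `b ∼ c` lie outside `A` and have no neighbour in `A`, every other
vertex outside `A` has a neighbour in `A` ("typed") and typed vertices are pairwise non-adjacent (so `A` is layered with typeless part
`{b, c}`), the graph is triangle-free; and the `V k` are up-sets meeting pairwise inside the core. -/
structure HandleHyp : Prop where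
  indA : ∀ u ∈ A, ∀ v ∈ A, ¬ Γ.Adj u v
  hbA : b ∉ A
  hcA : c ∉ A
  hb : ∀ a ∈ A, ¬ Γ.Adj a b
  hc : ∀ a ∈ A, ¬ Γ.Adj a c
  hbc : Γ.Adj b c
  cover : ∀ v, v ∉ A → v ≠ b → v ≠ c → ∃ a ∈ A, Γ.Adj a v
  indT : ∀ u v, u ∉ A → v ∉ A → (∃ a ∈ A, Γ.Adj a u) → (∃ a ∈ A, Γ.Adj a v) → ¬ Γ.Adj u v
  tf : Γ.CliqueFree 3
  up : ∀ k, IsUpperSet (V k)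
  cap : ∀ i j, i ≠ j → V i ∩ V j ⊆ SafeCalc.edgeCore Γ

variable {Γ A b c V}

/-- A cross edge between members of distinct petals. -/
theorem exists_cross_edge' (H : HandleHyp Γ A b c V) {i j : Fin K} (hij : i ≠ j) {α β : Set (Fin n)}
    (hα : α ∈ Wof Γ V i) (hβ : β ∈ Wof Γ V j) : ∃ u v, Γ.Adj u v ∧ u ∈ α ∧ u ∉ β ∧ v ∈ β ∧ v ∉ α := by
  have hcore : α ∪ β ∈ SafeCalc.edgeCore Γ :=
    H.cap i j hij ⟨H.up i Set.subset_union_left hα.1, H.up j Set.subset_union_right hβ.1⟩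
  obtain ⟨u, v, huv, hu, hv⟩ := hcore
  have hnα : ¬ (u ∈ α ∧ v ∈ α) := fun h => hα.2 ⟨u, v, huv, h.1, h.2⟩
  have hnβ : ¬ (u ∈ β ∧ v ∈ β) := fun h => hβ.2 ⟨u, v, huv, h.1, h.2⟩
  rcases hu with hu | hu <;> rcases hv with hv | hv
  · exact absurd ⟨hu, hv⟩ hnα
  · exact ⟨u, v, huv, hu, fun h => hnβ ⟨h, hv⟩, hv, fun h => hnα ⟨hu, h⟩⟩
  · exact ⟨v, u, huv.symm, hv, fun h => hnβ ⟨hu, h⟩, hu, fun h => hnα ⟨h, hv⟩⟩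
  · exact absurd ⟨hu, hv⟩ hnβ

/-- Two adjacent vertices outside `A`: one of them is `b` or `c`. -/
theorem special_of_adj (H : HandleHyp Γ A b c V) {u v : Fin n} (hu : u ∉ A) (hv : v ∉ A) (huv : Γ.Adj u v) :
    u = b ∨ u = c ∨ v = b ∨ v = c := by
  by_contra h
  push Not at h
  obtain ⟨h1, h2, h3, h4⟩ := h
  exact H.indT u v hu hv (H.cover u hu h1 h2) (H.cover v hv h3 h4) huv

variable (Γ A b c V) (SL : Fin n → Finset (Fin K))

/-- The mode of slot `k` under the free assignment `T`: `b` if the row holds `b`, else `c` if it holds `c`, else `none`. -/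
def modeT (hbA : b ∉ A) (hcA : c ∉ A) (T : Rv A → Finset (Fin K)) (k : Fin K) : Mode :=
  if k ∈ T ⟨b, hbA⟩ then Mode.b else if k ∈ T ⟨c, hcA⟩ then Mode.c else Mode.none

/-- The killer sets: `x` kills the extended slot `(k, β)` iff `x` has a neighbour in the `A`-part of slot `k`, or `β = b` and
`x ∈ N(b) ∖ {c}`, or `β = c` and `x ∈ N(c) ∖ {b}`. -/
def KillsT (x : Rv A) (e : Ext K) : Prop :=
  e.1 ∈ τOf Γ A SL x ∨ (e.2 = Mode.b ∧ Γ.Adj b x.1 ∧ x.1 ≠ c) ∨ (e.2 = Mode.c ∧ Γ.Adj c x.1 ∧ x.1 ≠ b)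

/-- A petal row of the extended slot `e` in petal `j`: a free completion of slot `e.1` of mode `e.2` lying in `Wof Γ V j`. -/
def PetRow (hbA : b ∉ A) (hcA : c ∉ A) (T : Rv A → Finset (Fin K)) (e : Ext K) (j : Fin K) : Prop :=
  rowOf A SL T e.1 ∈ Wof Γ V j ∧ modeT A b c hbA hcA T e.1 = e.2

variable {Γ A b c V SL}

/-- Membership of a free vertex in a row. -/
theorem mem_rowOf_of_free {T : Rv A → Finset (Fin K)} {k : Fin K} (x : Rv A) :
    x.1 ∈ rowOf A SL T k ↔ k ∈ T x := by
  unfold rowOf Cpart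
  simp only [Set.mem_union, Set.mem_setOf_eq]
  constructor
  · rintro (⟨hxA, -⟩ | ⟨y, hy, hyx⟩)
    · exact absurd hxA x.2
    · rw [Subtype.ext hyx] at hy; exact hy
  · intro h; exact Or.inr ⟨x, h, rfl⟩

/-- A member of a row outside the `A`-part is a free vertex of that row. -/
theorem exists_free_of_mem_rowOf {T : Rv A → Finset (Fin K)} {k : Fin K} {u : Fin n} (hu : u ∈ rowOf A SL T k)
    (huA : u ∉ A) : ∃ x : Rv A, k ∈ T x ∧ x.1 = u := by
  rcases hu with hu | h
  · exact absurd hu.1 huA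
  · exact h

/-- A member of the `A`-part of a row. -/
theorem mem_SL_of_mem_rowOf {T : Rv A → Finset (Fin K)} {k : Fin K} {u : Fin n} (hu : u ∈ rowOf A SL T k)
    (huA : u ∈ A) : k ∈ SL u := by
  rcases hu with hu | ⟨x, -, hx⟩
  · exact hu.2
  · exact absurd (hx ▸ huA) x.2

/-- A petal row is independent; in particular it does not hold both `b` and `c`. -/
theorem not_both_of_mem_Wof (H : HandleHyp Γ A b c V) {T : Rv A → Finset (Fin K)} {k j : Fin K}
    (h : rowOf A SL T k ∈ Wof Γ V j) : ¬ (k ∈ T ⟨b, H.hbA⟩ ∧ k ∈ T ⟨c, H.hcA⟩) := by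
  rintro ⟨hb', hc'⟩
  apply h.2
  exact ⟨b, c, H.hbc, (mem_rowOf_of_free ⟨b, H.hbA⟩).2 hb', (mem_rowOf_of_free ⟨c, H.hcA⟩).2 hc'⟩

/-- The mode is `b` iff the row holds `b`. -/
theorem modeT_eq_b_iff (hbA : b ∉ A) (hcA : c ∉ A) (T : Rv A → Finset (Fin K)) (k : Fin K) :
    modeT A b c hbA hcA T k = Mode.b ↔ k ∈ T ⟨b, hbA⟩ := by
  unfold modeT
  split_ifs with h1 h2 <;> simp [h1]

/-- For an independent row, the mode is `c` iff the row holds `c`. -/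
theorem modeT_eq_c_iff (H : HandleHyp Γ A b c V) {T : Rv A → Finset (Fin K)} {k j : Fin K}
    (h : rowOf A SL T k ∈ Wof Γ V j) : modeT A b c H.hbA H.hcA T k = Mode.c ↔ k ∈ T ⟨c, H.hcA⟩ := by
  have hnb := not_both_of_mem_Wof H h
  unfold modeT
  split_ifs with h1 h2
  · simp only [false_iff]; exact fun hc' => hnb ⟨h1, hc'⟩
  · simp [h2]
  · simp [h2]

/-- ONE LABEL PER EXTENDED SLOT: two free completions of the same slot with the same mode cannot lie in distinct petals. [this work] -/
theorem eq_of_petRow (H : HandleHyp Γ A b c V) {e : Ext K} {T T' : Rv A → Finset (Fin K)} {j j' : Fin K}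
    (hj : PetRow Γ A b c V SL H.hbA H.hcA T e j) (hj' : PetRow Γ A b c V SL H.hbA H.hcA T' e j') : j = j' := by
  by_contra hne
  obtain ⟨u, v, huv, hu, hnu, hv, hnv⟩ := exists_cross_edge' H hne hj.1 hj'.1
  -- both endpoints are free (the A-parts coincide)
  have huA : u ∉ A := fun huA => hnu (Or.inl ⟨huA, mem_SL_of_mem_rowOf hu huA⟩)
  have hvA : v ∉ A := fun hvA => hnv (Or.inl ⟨hvA, mem_SL_of_mem_rowOf hv hvA⟩)
  obtain ⟨x, hkx, rfl⟩ := exists_free_of_mem_rowOf hu huA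
  obtain ⟨y, hky, rfl⟩ := exists_free_of_mem_rowOf hv hvA
  have hmode : modeT A b c H.hbA H.hcA T e.1 = modeT A b c H.hbA H.hcA T' e.1 := by rw [hj.2, hj'.2]
  have hxn : e.1 ∉ T' x := fun h => hnu ((mem_rowOf_of_free x).2 h)
  have hyn : e.1 ∉ T y := fun h => hnv ((mem_rowOf_of_free y).2 h)
  -- one endpoint is b or c
  rcases special_of_adj H x.2 y.2 huv with hxb | hxc | hyb | hyc
  · have hx : x = ⟨b, H.hbA⟩ := Subtype.ext hxb
    subst hx
    have h1 := (modeT_eq_b_iff H.hbA H.hcA T e.1).2 hkx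
    rw [hmode, modeT_eq_b_iff] at h1
    exact hxn h1
  · have hx : x = ⟨c, H.hcA⟩ := Subtype.ext hxc
    subst hx
    have h1 := (modeT_eq_c_iff H hj.1).2 hkx
    rw [hmode, modeT_eq_c_iff H hj'.1] at h1
    exact hxn h1
  · have hy : y = ⟨b, H.hbA⟩ := Subtype.ext hyb
    subst hy
    have h1 := (modeT_eq_b_iff H.hbA H.hcA T' e.1).2 hky
    rw [← hmode, modeT_eq_b_iff] at h1
    exact hyn h1
  · have hy : y = ⟨c, H.hcA⟩ := Subtype.ext hyc
    subst hy
    have h1 := (modeT_eq_c_iff H hj'.1).2 hky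
    rw [← hmode, modeT_eq_c_iff H hj.1] at h1
    exact hyn h1

variable (Γ A b c V SL)

/-- The label of an extended slot: the (unique) petal containing a free completion of that slot and mode, if any. -/
noncomputable def labH (hbA : b ∉ A) (hcA : c ∉ A) (e : Ext K) : Option (Fin K) := by
  classical
  exact if h : ∃ j, ∃ T : Rv A → Finset (Fin K), PetRow Γ A b c V SL hbA hcA T e j then some (Classical.choose h) else none

variable {Γ A b c V SL}

/-- If a free completion of `e` lies in petal `j`, the label of `e` is `j`. [this work] -/
theorem labH_eq_some (H : HandleHyp Γ A b c V) {e : Ext K} {j : Fin K} {T : Rv A → Finset (Fin K)}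
    (h : PetRow Γ A b c V SL H.hbA H.hcA T e j) : labH Γ A b c V SL H.hbA H.hcA e = some j := by
  classical
  unfold labH
  have hex : ∃ j, ∃ T : Rv A → Finset (Fin K), PetRow Γ A b c V SL H.hbA H.hcA T e j := ⟨j, T, h⟩
  rw [dif_pos hex]
  obtain ⟨T', hT'⟩ := Classical.choose_spec hex
  rw [eq_of_petRow H hT' h]

/-- The mode is `c` only if the row holds `c`. -/
theorem mem_of_modeT_eq_c (hbA : b ∉ A) (hcA : c ∉ A) {T : Rv A → Finset (Fin K)} {k : Fin K}
    (h : modeT A b c hbA hcA T k = Mode.c) : k ∈ T ⟨c, hcA⟩ := by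
  unfold modeT at h
  split_ifs at h with h1 h2
  exact h2

end Handle

end Bridge

end Summit.CriticalPhenomena.PercolationContinuityZ3.Theorems.SunflowerPartition
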